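import Literature.AnabelianGeometry.EtaleTheta.ThetaRootOrbits
import HarnessLib

/-!
# [EtTh] Cor 2.8 (i) over the interface `ThetaOrbitData`: the typed schema `Cor28_i` is INHABITED at a
# standard-type orbit datum over EVERY `T` — the saturated («junk-positive by design») datum

S. Mochizuki, *The étale theta function and its Frobenioid-theoretic manifestations* [EtTh], Publ. RIMS **45**
(2009), §2, Def. 2.7 p. 41, Cor. 2.8 (i) p. 42 (PRIMS text pages) [cite: MochizukiEtTh2009, Cor 2.8(i) p.42].
Cell `abc-iut`, F lane (FACT-LIST row F-0640 `ThetaOrbitData.Cor28_i`, label «∀-closure REFUTED / schema» by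
abc-iut-w4-d051's `ThetaOrbitData.not_forall_cor28_i`, `ThetaRootOrbitsSchemaWitness.lean`), seat abc-iut-f-128
(gen 14); shape = abc-iut-w6-d049's OFFER A (abc-iut-L2-lead R1382: «F-lit's call for the FACT census; excluded from
the L2 node books by policy»).

WHAT THIS FILE IS.  abc-iut-L2-t2's `ThetaOrbitData T` (`ThetaRootOrbits.lean`) carries the orbit collections
`η̈^{Θ,ℤ×μ₂} ⊇ η̈^{Θ,l·ℤ×μ₂} ⊇ η̈^{Θ,l·ℤ}` and `η̲̈^{Θ,l·ℤ×μ₂} ⊇ η̲̈^{Θ,l·ℤ}` as FREE DATA (sets of sets of functions).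
The refuter fills them with a class that an inner automorphism moves; this file fills them with the SATURATED
choice — every `Ÿ`-collection `:= Set.univ`, both root collections `:= ∅` — keeping `top ⊇ bot` (`Δ_Θ`) and `Dtau`
of an arbitrary given datum `O` (`ThetaOrbitData.saturate`).  Then `O.saturate` is of standard type
(`isStandard_saturate`: the trivial class on any `D ∈ Dtau`) and satisfies the typed Cor. 2.8 (i) for EVERY
topological automorphism `Γ` of `Π^tp_C` and every induced `Γ_Θ` (`cor28_i_saturate`): transport by an admissible
pair and twisting are bijections on sets of functions, so `Set.univ` and `∅` are carried to themselves and the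
«root of unity» is `κ = 1`.  In particular this holds over the cover of record's own `T` and `Δ_Θ`/`Dtau`
(`O :=` abc-iut-L2-t2's `ofEmbedding …`).

HONEST LABEL: **JUNK-POSITIVE BY DESIGN** — it shows only that the typed predicate `Cor28_i` is SATISFIABLE at a
standard-type datum with the `Γ`-quantifier genuinely universal, i.e. that F-0640 is a genuine SCHEMA (closure
refuted ∧ instance inhabited); it carries NO rigidity content and says nothing about [EtTh] Cor. 2.8 (i) in print,
whose content at the natural instance is abc-iut-L2's conditional closer at the cover of record
(`Discharge/Sec2Cor28iCoverOfRecordThetaRigidityAlone.lean`, ⟸ `hη₁`; unconditional status = the parked question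
(E) «AUT-CLASSIFICATION @ modelχ′»).  DEF-BEARING (one definition `ThetaOrbitData.saturate`; no frozen structure is
edited; the interface is instantiated, not restated).  No bearing on [IUTchIII] Cor. 3.12; no side taken; typed ≠ proved.
-/

namespace Literature.AnabelianGeometry.EtaleTheta

namespace ThetaCovers

namespace ThetaOrbitData

universe u

variable {l : ℕ} {T : TemperedCoverData.{u} l} (O : ThetaOrbitData T)

/-- **The saturated orbit datum** over the cyclotome `Δ_Θ = top/bot` and the decomposition data `Dtau` of a given
`O`: every `Ÿ`-collection is `Set.univ` (all sets of functions `Π^tp_Ÿ → Δ_Θ`), both root collections are `∅`.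
JUNK-POSITIVE BY DESIGN (see the file header). [cite: MochizukiEtTh2009, Def 2.7 p.41] -/
def saturate : ThetaOrbitData T where
  top := O.top
  bot := O.bot
  bot_le := O.bot_le
  top_normal := O.top_normal
  bot_normal := O.bot_normal
  top_le := O.top_le
  Dtau := O.Dtau
  Dtau_le := O.Dtau_le
  Dtau_nonempty := O.Dtau_nonempty
  Dtau_aug := O.Dtau_aug
  etaZMu2 := Set.univ
  etaLZMu2 := Set.univ
  etaLZ := Set.univ
  etaLZ_sub := ⟨subset_rfl, subset_rfl⟩
  rootLZMu2 := ∅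
  rootLZ := ∅
  rootLZ_sub := subset_rfl
  root_pow := fun _ hc => (Set.notMem_empty _ hc).elim

/-- The cyclotome of the saturated datum is that of `O` (same `top ⊇ bot`). [cite: MochizukiEtTh2009, Def 2.7 p.41] -/
theorem saturate_top : O.saturate.top = O.top := rfl

/-- The decomposition data of the saturated datum are those of `O`. [cite: MochizukiEtTh2009, Def 2.7 p.41] -/
theorem saturate_Dtau : O.saturate.Dtau = O.Dtau := rfl

/-- `Set.univ` is of standard type for any datum: the trivial "class" `{1}` restricts on any `D ∈ Dtau` to the
class killed by `2` (witness `d = 1`). [cite: MochizukiEtTh2009, Def 2.7 p.41] -/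
theorem isStandardColl_univ : O.IsStandardColl Set.univ := by
  obtain ⟨D, hD⟩ := O.Dtau_nonempty
  refine ⟨D, hD, {fun _ => 1}, Set.mem_univ _, fun _ => 1, Set.mem_singleton _, 1, fun g _ => ?_⟩
  rw [one_pow, map_one, inv_one, mul_one]

/-- An automorphism `Γ` with `H.map Γ = H` maps `H` into `H` … [cite: MochizukiEtTh2009, Cor 2.8(i) p.42] -/
theorem mem_of_map_eq {H : Subgroup T.Gtp} {Γ : T.Gtp ≃ₜ* T.Gtp} (hH : H.map Γ.toMulEquiv.toMonoidHom = H)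
    (g : ↥H) : Γ g ∈ H :=
  hH.le (Subgroup.mem_map.mpr ⟨g, g.2, rfl⟩)

/-- … and so does `Γ⁻¹`. [cite: MochizukiEtTh2009, Cor 2.8(i) p.42] -/
theorem symm_mem_of_map_eq {H : Subgroup T.Gtp} {Γ : T.Gtp ≃ₜ* T.Gtp} (hH : H.map Γ.toMulEquiv.toMonoidHom = H)
    (h : ↥H) : Γ.symm h ∈ H := by
  obtain ⟨x, hx, hxh⟩ := Subgroup.mem_map.mp (hH.ge h.2)
  have hx' : Γ.symm (h : T.Gtp) = x := by
    rw [← hxh]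
    exact Γ.symm_apply_apply x
  rw [hx']
  exact hx

/-- Transport by an admissible pair `(Γ, Γ_Θ)` carries `Set.univ` onto `Set.univ` (it is the image map of a
bijection on functions `H → Δ_Θ`). [cite: MochizukiEtTh2009, Cor 2.8(i) p.42] -/
theorem transport_univ (H : Subgroup T.Gtp) (Γ : T.Gtp ≃ₜ* T.Gtp) (hH : H.map Γ.toMulEquiv.toMonoidHom = H)
    (ΓΘ : O.DeltaTheta ≃* O.DeltaTheta) : O.transport H Γ hH ΓΘ Set.univ = Set.univ := by
  refine Set.eq_univ_of_forall fun c' => ?_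
  -- the inverse transport of `c'`
  refine ⟨(fun η' => fun h : ↥H => ΓΘ (η' ⟨Γ.symm h, symm_mem_of_map_eq hH h⟩)) '' c', Set.mem_univ _, ?_⟩
  beta_reduce
  rw [Set.image_image]
  convert Set.image_id c' using 2 with η'
  funext g
  change ΓΘ.symm (ΓΘ (η' ⟨Γ.symm (Γ g), _⟩)) = η' g
  rw [ΓΘ.symm_apply_apply]
  congr 1
  exact Subtype.ext (Γ.symm_apply_apply (g : T.Gtp))

/-- Transport carries `∅` to `∅`. [cite: MochizukiEtTh2009, Cor 2.8(i) p.42] -/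
theorem transport_empty (H : Subgroup T.Gtp) (Γ : T.Gtp ≃ₜ* T.Gtp) (hH : H.map Γ.toMulEquiv.toMonoidHom = H)
    (ΓΘ : O.DeltaTheta ≃* O.DeltaTheta) : O.transport H Γ hH ΓΘ ∅ = ∅ :=
  Set.image_empty _

/-- Twisting by any `κ` carries `Set.univ` onto `Set.univ`. [cite: MochizukiEtTh2009, Cor 2.8(i) p.42] -/
theorem twist_univ (H : Subgroup T.Gtp) (κ : T.Gtp → O.DeltaTheta) : O.twist H κ Set.univ = Set.univ := by
  refine Set.eq_univ_of_forall fun c' => ?_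
  refine ⟨(fun η' => fun g : ↥H => η' g * (κ g)⁻¹) '' c', Set.mem_univ _, ?_⟩
  change (fun η => fun g : ↥H => η g * κ g) '' ((fun η' => fun g : ↥H => η' g * (κ g)⁻¹) '' c') = c'
  rw [Set.image_image]
  convert Set.image_id c' using 2 with η'
  funext g
  exact inv_mul_cancel_right (η' g) (κ g)

/-- Twisting carries `∅` to `∅`. [cite: MochizukiEtTh2009, Cor 2.8(i) p.42] -/
theorem twist_empty (H : Subgroup T.Gtp) (κ : T.Gtp → O.DeltaTheta) : O.twist H κ ∅ = ∅ :=
  Set.image_empty _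

/-- `Set.univ` equals itself «up to a root of unity of order `n`» for every `n` (witness `κ = 1`).
[cite: MochizukiEtTh2009, Cor 2.8(i) p.42] -/
theorem eqUpToRootOfUnity_univ (n : ℕ) (H : Subgroup T.Gtp) : O.EqUpToRootOfUnity n H Set.univ Set.univ := by
  refine ⟨fun _ => 1, fun _ _ _ => rfl, fun x _ => ?_, ⟨1, fun x => ?_⟩, (O.twist_univ H _).symm⟩
  · rw [map_one, mul_one]
  · rw [one_pow, map_one, inv_one, mul_one]

/-- `∅` equals itself «up to a root of unity of order `n`» for every `n` (witness `κ = 1`).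
[cite: MochizukiEtTh2009, Cor 2.8(i) p.42] -/
theorem eqUpToRootOfUnity_empty (n : ℕ) (H : Subgroup T.Gtp) : O.EqUpToRootOfUnity n H ∅ ∅ := by
  refine ⟨fun _ => 1, fun _ _ _ => rfl, fun x _ => ?_, ⟨1, fun x => ?_⟩, (O.twist_empty H _).symm⟩
  · rw [map_one, mul_one]
  · rw [one_pow, map_one, inv_one, mul_one]

/-- **The saturated datum is of standard type.** JUNK-POSITIVE BY DESIGN. [cite: MochizukiEtTh2009, Def 2.7 p.41] -/
theorem isStandard_saturate : O.saturate.IsStandard :=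
  O.saturate.isStandardColl_univ

/-- **F-0640 `ThetaOrbitData.Cor28_i` is INHABITED**: the typed Cor. 2.8 (i) holds at the saturated orbit datum over
EVERY `T : TemperedCoverData l` and every cyclotome/decomposition data (those of any `O`), for EVERY topological
automorphism `Γ` of `Π^tp_C` and every induced `Γ_Θ` — all four clauses with the root of unity `κ = 1`.
JUNK-POSITIVE BY DESIGN: together with abc-iut-w4-d051's `not_forall_cor28_i` it records that F-0640 is a genuine
SCHEMA (universal closure refuted, instance form satisfiable at a standard-type datum); no rigidity content; not a
statement about [EtTh] Cor. 2.8 (i) in print. [cite: MochizukiEtTh2009, Cor 2.8(i) p.42] -/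
theorem cor28_i_saturate : O.saturate.Cor28_i := by
  intro _ Γ ΓΘ _ _ hY hYuu
  refine ⟨?_, fun _ => ?_, fun _ => ?_, fun _ => ?_⟩
  · change O.saturate.IsStandardColl (O.saturate.transport _ Γ hY ΓΘ Set.univ)
    rw [O.saturate.transport_univ]
    exact O.saturate.isStandardColl_univ
  · change O.saturate.EqUpToRootOfUnity l _ ∅ (O.saturate.transport _ Γ hYuu ΓΘ ∅)
    rw [O.saturate.transport_empty]
    exact O.saturate.eqUpToRootOfUnity_empty l _
  · change O.saturate.EqUpToRootOfUnity 1 _ Set.univ (O.saturate.transport _ Γ hY ΓΘ Set.univ)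
    rw [O.saturate.transport_univ]
    exact O.saturate.eqUpToRootOfUnity_univ 1 _
  · change O.saturate.EqUpToRootOfUnity 1 _ Set.univ (O.saturate.transport _ Γ hY ΓΘ Set.univ)
    rw [O.saturate.transport_univ]
    exact O.saturate.eqUpToRootOfUnity_univ 1 _

/-- Both signs at once: over every `T` carrying some orbit datum there are standard-type data satisfying AND violating
nothing here — precisely: a standard-type datum satisfying the typed Cor. 2.8 (i) exists over every `T` that carries
any `ThetaOrbitData` at all (the refuting datum of `ThetaRootOrbitsSchemaWitness.lean` needs more of `T`).
JUNK-POSITIVE BY DESIGN. [cite: MochizukiEtTh2009, Cor 2.8(i) p.42] -/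
theorem exists_isStandard_and_cor28_i (O : ThetaOrbitData T) :
    ∃ O' : ThetaOrbitData T, O'.top = O.top ∧ O'.bot = O.bot ∧ O'.Dtau = O.Dtau ∧ O'.IsStandard ∧ O'.Cor28_i :=
  ⟨O.saturate, rfl, rfl, rfl, O.isStandard_saturate, O.cor28_i_saturate⟩

end ThetaOrbitData

end ThetaCovers

end Literature.AnabelianGeometry.EtaleTheta
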